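import Summits.QuantumAdvantage.AdviceFreeQNC0.AffineStakesCalc
import Mathlib.Data.Finset.SymmDiff
import HarnessLib

/-!
# Cell qa-qnc0 — the TRIPLE-PROJECTION engine: master identity and drop-out rule (planner qa-qnc0-p1 g19,
ROUND-18 §3.9; `exp19/Sketch19.lean` §8, definitions VERBATIM)

For a family `𝓕` of coin sets and a stake table `b`, `projQ 𝓕 b x j := ⊕_{F ∈ 𝓕} b(x^F)_j` (`x^F = flipAt x F`).

* `kline_flipEven` (M1′) — flipping an even set of coins keeps the odd class and the kernel line
  (directly from `inKernel_flipAt_iff` + uniqueness; no induction needed);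
* `master_identity` — if every `F ∈ 𝓕` is an even set of particles of `J(x)`, then
  `#{F ∈ 𝓕 : WIN(x^F)} ≡ ⟨J(x), projQ 𝓕 (stake z) x⟩ (mod 2)` (the win bit of `x^F` is `⟨J, b(x^F)⟩` since
  `J(x^F) = J(x)`; then `𝔽₂`-bilinearity, written with `bitVal` sums and `Finset.sum_comm`);
* `projQ_evenSubsets_eq_false` — DROP-OUT RULE: for `𝓕 = evenSubsets Q`, a bell `j` whose stake ignores two
  distinct coordinates `q₁, q₂ ∈ Q` has `projQ 𝓕 b x j = false`: `F ↦ F ∆ {q₁, q₂}` is an involution of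
  `{F ∈ evenSubsets Q : b(x^F)_j}` switching the predicate `q₁ ∈ F`, so that set has even size
  (`two_mul_card_filter_of_invol`).

WHAT THIS IS NOT: the AP-MAJ₃ toy (`apMaj3_triple`, `ApMaj3Lt`) is not here; crux 22907 untouched;
separation NOT moved.
-/

namespace Summit.QuantumAdvantage.AdviceFreeQNC0.Fib19

open Finset Literature.Computability.QuantumComplexity Literature.Computability.QuantumComplexity.RingHLF
open scoped symmDiff

variable {n : ℕ}

/-! ### §8 vocabulary (Sketch19 §8, verbatim) -/

/-- XOR-projection of a stake table `b` over a family `𝓕` of coin flips. -/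
def projQ (𝓕 : Finset (Finset (Fin n))) (b : (Fin n → Bool) → (Fin n → Bool)) (x : Fin n → Bool) :
    Fin n → Bool :=
  fun j => decide ((𝓕.filter fun F => b (flipAt x F) j = true).card % 2 = 1)

/-- The even subsets of `Q`. -/
def evenSubsets (Q : Finset (Fin n)) : Finset (Finset (Fin n)) :=
  Q.powerset.filter fun F => F.card % 2 = 0

/-- Bell `j` of the table `b` ignores coordinate `q`. -/
def Ignores (b : (Fin n → Bool) → (Fin n → Bool)) (j q : Fin n) : Prop :=
  ∀ x : Fin n → Bool, b (flipAt x {q}) j = b x j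

/-! ### M1′ and the master identity -/

/-- **M1′.** Flipping an even set of coins keeps the odd class and the kernel line. -/
theorem kline_flipEven (hn : 3 ≤ n) (x : Fin n → Bool) (hodd : IsOdd x) (F : Finset (Fin n))
    (hF : ∀ q ∈ F, kline x q = false) (hEven : F.card % 2 = 0) :
    IsOdd (flipAt x F) ∧ kline (flipAt x F) = kline x := by
  have hodd' : IsOdd (flipAt x F) := (isOdd_flipAt_of_even x F hEven).2 hodd
  exact ⟨hodd', (kline_eq_iff_inKernel hn _ hodd' (kline_ne_zero hn x hodd)).2
    ((inKernel_flipAt_iff x (kline x) F hF).2 (kline_inKernel hn x hodd))⟩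

/-- The projection bit in `𝔽₂`: `bitVal (projQ 𝓕 b x j) = Σ_{F ∈ 𝓕} b(x^F)_j`. -/
theorem bitVal_projQ (𝓕 : Finset (Finset (Fin n))) (b : (Fin n → Bool) → (Fin n → Bool)) (x : Fin n → Bool)
    (j : Fin n) : bitVal (projQ 𝓕 b x j) = ∑ F ∈ 𝓕, bitVal (b (flipAt x F) j) := by
  unfold projQ
  rw [bitVal_decide_mod_two, natCast_card_filter]
  refine sum_congr rfl fun F _ => ?_
  cases b (flipAt x F) j <;> simp [bitVal]

/-- Parity of a filtered count through a `{0,1}`-valued indicator (any decidability instance `hdec`, taken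
implicitly so that it unifies with classical instances in statements). -/
theorem card_filter_mod_two_eq {α : Type*} (s : Finset α) (p : α → Prop) {hdec : DecidablePred p} (f : α → ℕ)
    (hf : ∀ a ∈ s, f a < 2) (hp : ∀ a ∈ s, (p a ↔ f a = 1)) :
    (s.filter p).card % 2 = (∑ a ∈ s, f a) % 2 := by
  have h : (((s.filter p).card : ℕ) : ZMod 2) = ((∑ a ∈ s, f a : ℕ) : ZMod 2) := by
    rw [natCast_card_filter, Nat.cast_sum]
    refine sum_congr rfl fun a ha => ?_
    by_cases hpa : p a
    · rw [if_pos hpa, (hp a ha).1 hpa, Nat.cast_one]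
    · rw [if_neg hpa]
      have h1 : f a ≠ 1 := fun h => hpa ((hp a ha).2 h)
      have h0 : f a = 0 := by have := hf a ha; omega
      rw [h0, Nat.cast_zero]
  exact (ZMod.natCast_eq_natCast_iff' _ _ 2).1 h

/-- **MASTER IDENTITY** (`rel_iff_stake` + M1′ + bilinearity of `dot2`): if every `F ∈ 𝓕` is an even set of
particles of `J(x)`, then `#{F ∈ 𝓕 : WIN(x^F)} ≡ ⟨J(x), projQ 𝓕 (stake z) x⟩ (mod 2)`. -/
theorem master_identity (hn : 3 ≤ n) (z : (Fin n → Bool) → (Fin n → Bool)) (x : Fin n → Bool)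
    (hodd : IsOdd x) (𝓕 : Finset (Finset (Fin n)))
    (h𝓕 : ∀ F ∈ 𝓕, (∀ q ∈ F, kline x q = false) ∧ F.card % 2 = 0) :
    haveI : DecidablePred (fun F : Finset (Fin n) => Rel (flipAt x F) (z (flipAt x F))) :=
      fun _ => Classical.propDecidable _
    (𝓕.filter fun F => Rel (flipAt x F) (z (flipAt x F))).card % 2 =
      dot2 (kline x) (projQ 𝓕 (stake z) x) := by
  have hW : ∀ F ∈ 𝓕, (Rel (flipAt x F) (z (flipAt x F)) ↔ dot2 (kline x) (stake z (flipAt x F)) = 1) := by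
    intro F hF
    obtain ⟨ho, hk⟩ := kline_flipEven hn x hodd F (h𝓕 F hF).1 (h𝓕 F hF).2
    rw [rel_iff_stake hn z _ ho, hk]
  rw [card_filter_mod_two_eq 𝓕 _ (fun F => dot2 (kline x) (stake z (flipAt x F)))
    (fun F _ => Nat.mod_lt _ two_pos) hW]
  -- now a statement about `{0,1}`-valued naturals: compare in `ZMod 2`
  have hr : dot2 (kline x) (projQ 𝓕 (stake z) x) < 2 := Nat.mod_lt _ two_pos
  suffices h : (((∑ F ∈ 𝓕, dot2 (kline x) (stake z (flipAt x F))) % 2 : ℕ) : ZMod 2) =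
      ((dot2 (kline x) (projQ 𝓕 (stake z) x) : ℕ) : ZMod 2) by
    have h' := (ZMod.natCast_eq_natCast_iff' _ _ 2).1 h
    rw [Nat.mod_mod, Nat.mod_eq_of_lt hr] at h'
    exact h'
  rw [ZMod.natCast_mod, Nat.cast_sum, natCast_dot2]
  simp_rw [natCast_dot2, bitVal_projQ, mul_sum]
  rw [sum_comm]

/-! ### The drop-out rule -/

/-- Flipping on `F ∆ {q₁, q₂}` is flipping on `F`, then at `q₁`, then at `q₂`. -/
theorem flipAt_symmDiff_pair (x : Fin n → Bool) (F : Finset (Fin n)) {q₁ q₂ : Fin n} (hq : q₁ ≠ q₂) :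
    flipAt x (F ∆ {q₁, q₂}) = flipAt (flipAt (flipAt x F) {q₁}) {q₂} := by
  funext i
  have m1 : ∀ {y : Fin n → Bool}, i = q₁ → flipAt y {q₁} i = !y i := fun h => flipAt_apply_of_mem (by simp [h])
  have m1' : ∀ {y : Fin n → Bool}, i ≠ q₁ → flipAt y {q₁} i = y i := fun h => flipAt_apply_of_not_mem (by simp [h])
  have m2 : ∀ {y : Fin n → Bool}, i = q₂ → flipAt y {q₂} i = !y i := fun h => flipAt_apply_of_mem (by simp [h])
  have m2' : ∀ {y : Fin n → Bool}, i ≠ q₂ → flipAt y {q₂} i = y i := fun h => flipAt_apply_of_not_mem (by simp [h])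
  by_cases h1 : i = q₁
  · have h2 : i ≠ q₂ := fun h => hq (h1.symm.trans h)
    by_cases hF : i ∈ F
    · rw [m2' h2, m1 h1, flipAt_apply_of_mem hF, flipAt_apply_of_not_mem (by
        rw [mem_symmDiff]; push Not; exact ⟨fun _ => by simp [h1], fun _ => hF⟩)]
      cases x i <;> rfl
    · rw [m2' h2, m1 h1, flipAt_apply_of_not_mem hF, flipAt_apply_of_mem (by
        rw [mem_symmDiff]; exact Or.inr ⟨by simp [h1], hF⟩)]
  · by_cases h2 : i = q₂
    · by_cases hF : i ∈ F
      · rw [m2 h2, m1' h1, flipAt_apply_of_mem hF, flipAt_apply_of_not_mem (by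
          rw [mem_symmDiff]; push Not; exact ⟨fun _ => by simp [h2], fun _ => hF⟩)]
        cases x i <;> rfl
      · rw [m2 h2, m1' h1, flipAt_apply_of_not_mem hF, flipAt_apply_of_mem (by
          rw [mem_symmDiff]; exact Or.inr ⟨by simp [h2], hF⟩)]
    · have hP : i ∉ ({q₁, q₂} : Finset (Fin n)) := by simp [h1, h2]
      by_cases hF : i ∈ F
      · rw [m2' h2, m1' h1, flipAt_apply_of_mem hF, flipAt_apply_of_mem (by
          rw [mem_symmDiff]; exact Or.inl ⟨hF, hP⟩)]
      · rw [m2' h2, m1' h1, flipAt_apply_of_not_mem hF, flipAt_apply_of_not_mem (by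
          rw [mem_symmDiff]; push Not; exact ⟨fun h => absurd h hF, fun h => absurd h hP⟩)]

/-- The symmetric difference with a pair keeps the parity of the size. -/
theorem card_symmDiff_pair_mod_two (F : Finset (Fin n)) {q₁ q₂ : Fin n} (hq : q₁ ≠ q₂) :
    (F ∆ {q₁, q₂}).card % 2 = F.card % 2 := by
  have h1 : F ∆ {q₁, q₂} = (F ∪ {q₁, q₂}) \ (F ∩ {q₁, q₂}) := symmDiff_eq_sup_sdiff_inf F {q₁, q₂}
  have h2 := card_sdiff_add_card_eq_card (inter_subset_left.trans subset_union_left :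
    F ∩ {q₁, q₂} ⊆ F ∪ {q₁, q₂})
  have h3 := card_union_add_card_inter F {q₁, q₂}
  rw [card_pair hq] at h3
  rw [h1]
  omega

/-- **DROP-OUT RULE.** For `𝓕 = evenSubsets Q`, a bell `j` whose stake ignores two distinct coordinates
`q₁, q₂ ∈ Q` has zero projection (`F ↦ F ∆ {q₁, q₂}` is a fixed-point-free involution of `evenSubsets Q`
preserving `b (x^F) j`). -/
theorem projQ_evenSubsets_eq_false (b : (Fin n → Bool) → (Fin n → Bool)) (Q : Finset (Fin n))
    (x : Fin n → Bool) (j q₁ q₂ : Fin n) (hq : q₁ ≠ q₂) (h1 : q₁ ∈ Q) (h2 : q₂ ∈ Q)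
    (hi1 : Ignores b j q₁) (hi2 : Ignores b j q₂) :
    projQ (evenSubsets Q) b x j = false := by
  unfold projQ
  rw [decide_eq_false_iff_not]
  set S := (evenSubsets Q).filter fun F => b (flipAt x F) j = true with hS
  have hPQ : ({q₁, q₂} : Finset (Fin n)) ⊆ Q := by
    intro i hi
    rw [mem_insert, mem_singleton] at hi
    rcases hi with rfl | rfl
    · exact h1
    · exact h2
  have hval : ∀ F, b (flipAt x (F ∆ {q₁, q₂})) j = b (flipAt x F) j := by
    intro F
    rw [flipAt_symmDiff_pair x F hq, hi2, hi1]
  have hmem : ∀ F ∈ S, F ∆ {q₁, q₂} ∈ S := by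
    intro F hF
    simp only [hS, evenSubsets, mem_filter, mem_powerset] at hF ⊢
    obtain ⟨⟨hFQ, hFe⟩, hFb⟩ := hF
    refine ⟨⟨symmDiff_subset_union.trans (union_subset hFQ hPQ), ?_⟩, by rw [hval]; exact hFb⟩
    rw [card_symmDiff_pair_mod_two F hq]; exact hFe
  have hinv : ∀ F ∈ S, (F ∆ {q₁, q₂}) ∆ {q₁, q₂} = F := fun F _ => symmDiff_symmDiff_cancel_right _ _
  have hsw : ∀ F ∈ S, (q₁ ∈ F ∆ {q₁, q₂} ↔ ¬ q₁ ∈ F) := by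
    intro F _
    rw [mem_symmDiff]
    simp
  have h := two_mul_card_filter_of_invol S (fun F => q₁ ∈ F) (fun F => F ∆ {q₁, q₂}) hmem hinv hsw
  omega

end Summit.QuantumAdvantage.AdviceFreeQNC0.Fib19
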